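import Mathlib
import Summits.QuantumFields.YangMills.Theorems.ConvexGribovBodyContinuumLegGivenGapCsclTorusForms
import Summits.QuantumFields.YangMills.Theorems.ConvexGribovBodyContinuumLegGivenGapStubCsclReal
import HarnessLib

/-!
# `ContinuumLegGivenGap` (stmt-QuantumFields-15828), line `Sketch`, reshape 18: helpers for `stub_csclIvCS` (part A)

Support file for the crux item stmt-QuantumFields-15828 (registered glue stub `stub_csclIvCS` of line `Sketch`, reshape 18;
registered anchor of this file: `cscl_anchor_ivcsA`). Elementary torus kinematics and the abstract limit argument used by
`stub_csclIvCS` (lock + reflection positivity ⇒ asymptotic OS Cauchy–Schwarz clustering along growing tori):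
* `ivcs_integral_cfgReflect` — site-reflection invariance of the lifted Wilson state for complex integrands
  (`torusLift_negReflect`, `integral_comp_negReflect_eq`);
* `ivcs_centred` — `∫ conj (X(Θ₀Ũ) − E X)(Y(τˢŨ) − E Y) = ∫ conj X(Θ₀Ũ) Y(τˢŨ) − conj(E X) E Y`;
* `ivcs_far_bound` — the centred diagonal pairing of `X` is a signed sum of four connected time correlations of the local
  gauge-invariant observables `Re/Im X`, `Re/Im (X ∘ cfgReflect)` (so the locked lattice gap bounds it);
* `ivcs_abstract` — the limit argument: chord limit (`csclReal_chordLimit`, landed) for the diagonal, Cauchy–Schwarz for the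
  cross term, comparison of the two convergent sides.
No definitions, no facts; Mathlib + landed tree lemmas only. [folklore]
-/

noncomputable section

namespace Summit.QuantumFields.YangMills.Theorems.ContinuumLegGivenGap

open scoped SchwartzMap ComplexConjugate
open Filter Topology MeasureTheory
open Literature.MathematicalPhysics.QuantumFieldTheory Literature.MathematicalPhysics.QuantumLattice
  Literature.MathematicalPhysics.AQFT Literature.Probability.LatticeModels

section Helpers

variable {G : Type} [Group G] [TopologicalSpace G] [IsTopologicalGroup G] [CompactSpace G]
  [MeasurableSpace G] [BorelSpace G] {N : ℕ} (ρ : G →* Matrix (Fin N) (Fin N) ℂ)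

/-- **Site-reflection invariance along the lift** (complex integrands): `∫ g(cfgReflect Ũ) dμ = ∫ g(Ũ) dμ`
(`torusLift_negReflect` + `Θ'`-invariance of Wilson's torus measure, `integral_comp_negReflect_eq`). [folklore] -/
theorem ivcs_integral_cfgReflect (hρ : Continuous ρ) (β : ℝ) (L : ℕ) [NeZero L] (g : LGConfig 4 G → ℂ) :
    ∫ U, g (cfgReflect (torusLift L U)) ∂(wilsonMeasure (d := 4) (L := L) ρ β) =
      ∫ U, g (torusLift L U) ∂(wilsonMeasure (d := 4) (L := L) ρ β) := by
  simp_rw [← torusLift_negReflect]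
  exact integral_comp_negReflect_eq ρ hρ β (fun U => g (torusLift L U))

omit [CompactSpace G] in
/-- Measurability of an observable of the lift read through `cfgReflect`. [folklore] -/
theorem ivcs_measurable_cfgReflect {X : LGConfig 4 G → ℂ} (hX : Measurable X) (L : ℕ) :
    Measurable (fun U : GaugeConfig 4 L G => X (cfgReflect (torusLift L U))) :=
  hX.comp (measurable_cfgReflect.comp (measurable_torusLift _))

/-- **Centring identity**: for bounded measurable complex observables and the torus means `eX = E X`, `eY = E Y`,
`∫ conj (X(cfgReflect Ũ) − eX) (Y(τˢŨ) − eY) dμ = ∫ conj X(cfgReflect Ũ) Y(τˢŨ) dμ − conj eX · eY` (reflection and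
translation invariance of the torus Wilson state). [folklore] -/
theorem ivcs_centred (hρ : Continuous ρ) (β : ℝ) (L : ℕ) [NeZero L] {X Y : LGConfig 4 G → ℂ}
    (hXm : Measurable X) (hYm : Measurable Y) (hXb : ∃ C : ℝ, ∀ V, ‖X V‖ ≤ C) (hYb : ∃ C : ℝ, ∀ V, ‖Y V‖ ≤ C)
    (s : ℤ) :
    ∫ U, conj (X (cfgReflect (torusLift L U)) - ∫ V, X (torusLift L V) ∂(wilsonMeasure (d := 4) (L := L) ρ β)) *
        (Y (configShift (-(Pi.single 0 s)) (torusLift L U)) -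
          ∫ V, Y (torusLift L V) ∂(wilsonMeasure (d := 4) (L := L) ρ β)) ∂(wilsonMeasure (d := 4) (L := L) ρ β) =
      (∫ U, conj (X (cfgReflect (torusLift L U))) * Y (configShift (-(Pi.single 0 s)) (torusLift L U))
          ∂(wilsonMeasure (d := 4) (L := L) ρ β)) -
        conj (∫ V, X (torusLift L V) ∂(wilsonMeasure (d := 4) (L := L) ρ β)) *
          ∫ V, Y (torusLift L V) ∂(wilsonMeasure (d := 4) (L := L) ρ β) := by
  haveI := isProbabilityMeasure_wilsonMeasure (d := 4) (L := L) ρ hρ β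
  obtain ⟨CX, hCX⟩ := hXb
  obtain ⟨CY, hCY⟩ := hYb
  set μ := wilsonMeasure (d := 4) (L := L) ρ β with hμ
  set eX : ℂ := ∫ V, X (torusLift L V) ∂μ with heX
  set eY : ℂ := ∫ V, Y (torusLift L V) ∂μ with heY
  -- integrable pieces
  have hA : Integrable (fun U : GaugeConfig 4 L G => conj (X (cfgReflect (torusLift L U)))) μ :=
    cscl_integrable ρ hρ β (Complex.continuous_conj.measurable.comp (ivcs_measurable_cfgReflect hXm L))
      ⟨CX, fun U => by rw [Complex.norm_conj]; exact hCX _⟩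
  have hB : Integrable (fun U : GaugeConfig 4 L G => Y (configShift (-(Pi.single 0 s)) (torusLift L U))) μ :=
    cscl_integrable ρ hρ β (cscl_measurable_comp hYm L s).2 ⟨CY, fun U => hCY _⟩
  have hAB : Integrable (fun U : GaugeConfig 4 L G => conj (X (cfgReflect (torusLift L U))) *
      Y (configShift (-(Pi.single 0 s)) (torusLift L U))) μ := by
    refine cscl_integrable ρ hρ β ((Complex.continuous_conj.measurable.comp
      (ivcs_measurable_cfgReflect hXm L)).mul (cscl_measurable_comp hYm L s).2) ⟨CX * CY, fun U => ?_⟩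
    rw [norm_mul, Complex.norm_conj]
    have hCX0 : 0 ≤ CX := (norm_nonneg _).trans (hCX (cfgReflect (torusLift L U)))
    exact mul_le_mul (hCX _) (hCY _) (norm_nonneg _) hCX0
  -- means of the pieces
  have hmA : ∫ U, conj (X (cfgReflect (torusLift L U))) ∂μ = conj eX := by
    rw [integral_conj, heX, hμ, ivcs_integral_cfgReflect ρ hρ β L X]
  have hmB : ∫ U, Y (configShift (-(Pi.single 0 s)) (torusLift L U)) ∂μ = eY := by
    rw [heY, hμ]
    exact cscl_integral_shift ρ β L _ Y
  -- pointwise expansion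
  have hpt : ∀ U : GaugeConfig 4 L G,
      conj (X (cfgReflect (torusLift L U)) - eX) * (Y (configShift (-(Pi.single 0 s)) (torusLift L U)) - eY) =
        conj (X (cfgReflect (torusLift L U))) * Y (configShift (-(Pi.single 0 s)) (torusLift L U)) -
          eY * conj (X (cfgReflect (torusLift L U))) -
          conj eX * Y (configShift (-(Pi.single 0 s)) (torusLift L U)) + conj eX * eY := by
    intro U; simp only [map_sub]; ring
  simp_rw [hpt]
  have h1 : Integrable (fun U : GaugeConfig 4 L G => eY * conj (X (cfgReflect (torusLift L U)))) μ :=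
    hA.const_mul eY
  have h2 : Integrable (fun U : GaugeConfig 4 L G =>
      conj eX * Y (configShift (-(Pi.single 0 s)) (torusLift L U))) μ := hB.const_mul _
  have h12 : Integrable (fun U : GaugeConfig 4 L G => conj (X (cfgReflect (torusLift L U))) *
      Y (configShift (-(Pi.single 0 s)) (torusLift L U)) - eY * conj (X (cfgReflect (torusLift L U)))) μ :=
    hAB.sub h1
  have h123 : Integrable (fun U : GaugeConfig 4 L G => conj (X (cfgReflect (torusLift L U))) *
      Y (configShift (-(Pi.single 0 s)) (torusLift L U)) - eY * conj (X (cfgReflect (torusLift L U))) -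
      conj eX * Y (configShift (-(Pi.single 0 s)) (torusLift L U))) μ := h12.sub h2
  rw [integral_add h123 (integrable_const _), integral_sub h12 h2, integral_sub hAB h1, integral_const_mul,
    integral_const_mul, hmA, hmB, integral_const]
  simp only [probReal_univ, one_smul]
  ring

/-- Bounded measurable real observables of the torus are integrable for Wilson's measure. [folklore] -/
theorem ivcs_integrable_real (hρ : Continuous ρ) (β : ℝ) {L : ℕ} [NeZero L] {f : GaugeConfig 4 L G → ℝ}
    (hf : Measurable f) (hb : ∃ C : ℝ, ∀ U, |f U| ≤ C) :
    Integrable f (wilsonMeasure (d := 4) (L := L) ρ β) := by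
  haveI := isProbabilityMeasure_wilsonMeasure (d := 4) (L := L) ρ hρ β
  obtain ⟨C, hC⟩ := hb
  exact Integrable.of_bound hf.aestronglyMeasurable C (Eventually.of_forall fun U => by
    rw [Real.norm_eq_abs]; exact hC U)

/-- A local gauge-invariant observable read on a measurably transformed lift is integrable. [folklore] -/
theorem ivcs_integrable_species (hρ : Continuous ρ) (β : ℝ) {L : ℕ} [NeZero L] (A : YMSpecies G)
    {T : GaugeConfig 4 L G → LGConfig 4 G} (hT : Measurable T) :
    Integrable (fun U => A.F (T U)) (wilsonMeasure (d := 4) (L := L) ρ β) := by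
  obtain ⟨C, hC⟩ := A.bounded
  exact ivcs_integrable_real ρ hρ β (A.measurable.comp hT) ⟨C, fun U => hC _⟩

/-- Products of two local gauge-invariant observables read on measurably transformed lifts are integrable. [folklore] -/
theorem ivcs_integrable_species_mul (hρ : Continuous ρ) (β : ℝ) {L : ℕ} [NeZero L] (A B : YMSpecies G)
    {T T' : GaugeConfig 4 L G → LGConfig 4 G} (hT : Measurable T) (hT' : Measurable T') :
    Integrable (fun U => A.F (T U) * B.F (T' U)) (wilsonMeasure (d := 4) (L := L) ρ β) := by
  obtain ⟨C, hC⟩ := A.bounded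
  obtain ⟨D, hD⟩ := B.bounded
  refine ivcs_integrable_real ρ hρ β ((A.measurable.comp hT).mul (B.measurable.comp hT')) ⟨C * D, fun U => ?_⟩
  rw [abs_mul]
  have hC0 : 0 ≤ C := (abs_nonneg _).trans (hC (T U))
  exact mul_le_mul (hC _) (hD _) (abs_nonneg _) hC0

/-- **The far-point bound from the lock's shape**: the centred diagonal pairing of a complex observable whose real and
imaginary parts (of `X` and of `X ∘ cfgReflect`) are local gauge-invariant observables is a signed sum of four connected
time correlations: its real part is `corr(A₁,A₃;n) + corr(A₂,A₄;n)`, its imaginary part `corr(A₁,A₄;n) − corr(A₂,A₃;n)`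
(the means of `A₁, A₂` are those of `A₃, A₄` by reflection invariance). [folklore] -/
theorem ivcs_far_bound (hρ : Continuous ρ) (β : ℝ) (S : ℕ) {X : LGConfig 4 G → ℂ} (hXm : Measurable X)
    (hXb : ∃ C : ℝ, ∀ V, ‖X V‖ ≤ C) (A₁ A₂ A₃ A₄ : YMSpecies G)
    (h₁ : ∀ V, A₁.F V = (X (cfgReflect V)).re) (h₂ : ∀ V, A₂.F V = (X (cfgReflect V)).im)
    (h₃ : ∀ V, A₃.F V = (X V).re) (h₄ : ∀ V, A₄.F V = (X V).im) (n : ℕ) :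
    ‖(∫ U : GaugeConfig 4 (2 * S + 1) G, conj (X (cfgReflect (torusLift (2 * S + 1) U))) *
          X (configShift (-(Pi.single 0 ((n : ℕ) : ℤ))) (torusLift (2 * S + 1) U)) ∂(wilsonMeasure ρ β)) -
        conj (∫ U : GaugeConfig 4 (2 * S + 1) G, X (torusLift (2 * S + 1) U) ∂(wilsonMeasure ρ β)) *
          ∫ U : GaugeConfig 4 (2 * S + 1) G, X (torusLift (2 * S + 1) U) ∂(wilsonMeasure ρ β)‖ ≤
      |latticeConnectedCorr ρ β (2 * S + 1) A₁.F A₃.F n| + |latticeConnectedCorr ρ β (2 * S + 1) A₂.F A₄.F n| +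
        |latticeConnectedCorr ρ β (2 * S + 1) A₁.F A₄.F n| + |latticeConnectedCorr ρ β (2 * S + 1) A₂.F A₃.F n| := by
  obtain ⟨CX, hCX⟩ := hXb
  -- the transformations of the lift
  have hTr : Measurable (fun U : GaugeConfig 4 (2 * S + 1) G => cfgReflect (torusLift (2 * S + 1) U)) :=
    measurable_cfgReflect.comp (measurable_torusLift _)
  have hTs : Measurable (fun U : GaugeConfig 4 (2 * S + 1) G => configShift (-(Pi.single 0 ((n : ℕ) : ℤ))) (torusLift (2 * S + 1) U)) :=
    (Literature.MathematicalPhysics.QuantumLattice.configShift _).measurable.comp (measurable_torusLift _)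
  have hTl : Measurable (fun U : GaugeConfig 4 (2 * S + 1) G => torusLift (2 * S + 1) U) := measurable_torusLift _
  -- the complex integrand and its integrability
  have hAB : Integrable (fun U : GaugeConfig 4 (2 * S + 1) G => conj (X (cfgReflect (torusLift (2 * S + 1) U))) *
      X (configShift (-(Pi.single 0 ((n : ℕ) : ℤ))) (torusLift (2 * S + 1) U))) (wilsonMeasure (d := 4) (L := 2 * S + 1) ρ β) := by
    refine cscl_integrable ρ hρ β ((Complex.continuous_conj.measurable.comp
      (ivcs_measurable_cfgReflect hXm (2 * S + 1))).mul (cscl_measurable_comp hXm (2 * S + 1) _).2) ⟨CX * CX, fun U => ?_⟩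
    rw [norm_mul, Complex.norm_conj]
    have hCX0 : 0 ≤ CX := (norm_nonneg _).trans (hCX (cfgReflect (torusLift (2 * S + 1) U)))
    exact mul_le_mul (hCX _) (hCX _) (norm_nonneg _) hCX0
  have hXl : Integrable (fun U : GaugeConfig 4 (2 * S + 1) G => X (torusLift (2 * S + 1) U)) (wilsonMeasure (d := 4) (L := 2 * S + 1) ρ β) :=
    cscl_integrable ρ hρ β (hXm.comp hTl) ⟨CX, fun U => hCX _⟩
  set e : ℂ := ∫ U, X (torusLift (2 * S + 1) U) ∂(wilsonMeasure (d := 4) (L := 2 * S + 1) ρ β) with he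
  -- means of the four species
  have hm₃ : ∫ U, A₃.F (torusLift (2 * S + 1) U) ∂(wilsonMeasure (d := 4) (L := 2 * S + 1) ρ β) = e.re := by
    simp_rw [h₃]
    have := integral_re hXl
    simpa using this
  have hm₄ : ∫ U, A₄.F (torusLift (2 * S + 1) U) ∂(wilsonMeasure (d := 4) (L := 2 * S + 1) ρ β) = e.im := by
    simp_rw [h₄]
    have := integral_im hXl
    simpa using this
  have hXr : Integrable (fun U : GaugeConfig 4 (2 * S + 1) G => X (cfgReflect (torusLift (2 * S + 1) U))) (wilsonMeasure (d := 4) (L := 2 * S + 1) ρ β) :=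
    cscl_integrable ρ hρ β (ivcs_measurable_cfgReflect hXm (2 * S + 1)) ⟨CX, fun U => hCX _⟩
  have her : ∫ U, X (cfgReflect (torusLift (2 * S + 1) U)) ∂(wilsonMeasure (d := 4) (L := 2 * S + 1) ρ β) = e := by
    rw [he]; exact ivcs_integral_cfgReflect ρ hρ β (2 * S + 1) X
  have hm₁ : ∫ U, A₁.F (torusLift (2 * S + 1) U) ∂(wilsonMeasure (d := 4) (L := 2 * S + 1) ρ β) = e.re := by
    have h1' : ∀ U : GaugeConfig 4 (2 * S + 1) G, A₁.F (torusLift (2 * S + 1) U) = (X (cfgReflect (torusLift (2 * S + 1) U))).re :=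
      fun U => h₁ _
    simp_rw [h1']
    have := integral_re hXr
    rw [her] at this
    simpa using this
  have hm₂ : ∫ U, A₂.F (torusLift (2 * S + 1) U) ∂(wilsonMeasure (d := 4) (L := 2 * S + 1) ρ β) = e.im := by
    have h2' : ∀ U : GaugeConfig 4 (2 * S + 1) G, A₂.F (torusLift (2 * S + 1) U) = (X (cfgReflect (torusLift (2 * S + 1) U))).im :=
      fun U => h₂ _
    simp_rw [h2']
    have := integral_im hXr
    rw [her] at this
    simpa using this
  -- real and imaginary parts of the pairing
  set T : ℂ := ∫ U, conj (X (cfgReflect (torusLift (2 * S + 1) U))) *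
      X (configShift (-(Pi.single 0 ((n : ℕ) : ℤ))) (torusLift (2 * S + 1) U)) ∂(wilsonMeasure (d := 4) (L := 2 * S + 1) ρ β) with hT
  have hTre : T.re = (∫ U, A₁.F (torusLift (2 * S + 1) U) * A₃.F (configShift (-(Pi.single 0 ((n : ℕ) : ℤ))) (torusLift (2 * S + 1) U)) ∂(wilsonMeasure (d := 4) (L := 2 * S + 1) ρ β)) +
      ∫ U, A₂.F (torusLift (2 * S + 1) U) * A₄.F (configShift (-(Pi.single 0 ((n : ℕ) : ℤ))) (torusLift (2 * S + 1) U)) ∂(wilsonMeasure (d := 4) (L := 2 * S + 1) ρ β) := by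
    have h := integral_re hAB
    simp only [RCLike.re_to_complex] at h
    rw [hT, ← h, ← integral_add (ivcs_integrable_species_mul ρ hρ β A₁ A₃ hTl hTs)
      (ivcs_integrable_species_mul ρ hρ β A₂ A₄ hTl hTs)]
    refine integral_congr_ae (Eventually.of_forall fun U => ?_)
    simp only [Complex.mul_re, Complex.conj_re, Complex.conj_im, h₁, h₂, h₃, h₄]
    ring
  have hTim : T.im = (∫ U, A₁.F (torusLift (2 * S + 1) U) * A₄.F (configShift (-(Pi.single 0 ((n : ℕ) : ℤ))) (torusLift (2 * S + 1) U)) ∂(wilsonMeasure (d := 4) (L := 2 * S + 1) ρ β)) -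
      ∫ U, A₂.F (torusLift (2 * S + 1) U) * A₃.F (configShift (-(Pi.single 0 ((n : ℕ) : ℤ))) (torusLift (2 * S + 1) U)) ∂(wilsonMeasure (d := 4) (L := 2 * S + 1) ρ β) := by
    have h := integral_im hAB
    simp only [RCLike.im_to_complex] at h
    rw [hT, ← h, ← integral_sub (ivcs_integrable_species_mul ρ hρ β A₁ A₄ hTl hTs)
      (ivcs_integrable_species_mul ρ hρ β A₂ A₃ hTl hTs)]
    refine integral_congr_ae (Eventually.of_forall fun U => ?_)
    simp only [Complex.mul_im, Complex.conj_re, Complex.conj_im, h₁, h₂, h₃, h₄]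
    ring
  -- assemble
  have hre : (T - conj e * e).re = latticeConnectedCorr ρ β (2 * S + 1) A₁.F A₃.F n + latticeConnectedCorr ρ β (2 * S + 1) A₂.F A₄.F n := by
    simp only [latticeConnectedCorr, Complex.sub_re, Complex.mul_re, Complex.conj_re, Complex.conj_im, hTre, hm₁,
      hm₂, hm₃, hm₄]
    ring
  have him : (T - conj e * e).im = latticeConnectedCorr ρ β (2 * S + 1) A₁.F A₄.F n - latticeConnectedCorr ρ β (2 * S + 1) A₂.F A₃.F n := by
    simp only [latticeConnectedCorr, Complex.sub_im, Complex.mul_im, Complex.conj_re, Complex.conj_im, hTim, hm₁,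
      hm₂, hm₃, hm₄]
    ring
  calc ‖T - conj e * e‖ ≤ |(T - conj e * e).re| + |(T - conj e * e).im| := Complex.norm_le_abs_re_add_abs_im _
    _ ≤ _ := by
      rw [hre, him]
      have h1 := abs_add_le (latticeConnectedCorr ρ β (2 * S + 1) A₁.F A₃.F n) (latticeConnectedCorr ρ β (2 * S + 1) A₂.F A₄.F n)
      have h2 := abs_sub (latticeConnectedCorr ρ β (2 * S + 1) A₁.F A₄.F n) (latticeConnectedCorr ρ β (2 * S + 1) A₂.F A₃.F n)
      linarith

/-- **The limit argument, abstractly**: non-negative midpoint-log-convex sequences `g_j` on `[0, ν_j]`, `ν_j → ∞`, with the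
far bound `g_j(ν_j) ≤ C e^{−μν_j}` and pointwise limits; a non-negative convergent `h_j`; a convergent complex `c_j` with
eventually `‖c_j‖² ≤ g_j(2σ) h_j`: then eventually `‖c_j‖ ≤ e^{−μσ} √g_j(0) √h_j + ε` (the landed chord limit
`csclReal_chordLimit` gives `lim g_j(2σ) ≤ lim g_j(0) · e^{−2μσ}`). [folklore] -/
theorem ivcs_abstract (μ C : ℝ) (σ : ℕ) (ν : ℕ → ℕ) (g : ℕ → ℕ → ℝ) (gl : ℕ → ℝ) (h0 : ℕ → ℝ) (hl : ℝ)
    (c : ℕ → ℂ) (cl : ℂ) (hμ : 0 < μ) (hν : Tendsto ν atTop atTop)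
    (hg0 : ∀ j s : ℕ, s ≤ ν j → 0 ≤ g j s)
    (hlc : ∀ j s : ℕ, s + 2 ≤ ν j → g j (s + 1) ^ 2 ≤ g j s * g j (s + 2))
    (hfar : ∀ j : ℕ, g j (ν j) ≤ C * Real.exp (-(μ * ν j)))
    (hgl : ∀ s : ℕ, Tendsto (fun j => g j s) atTop (𝓝 (gl s)))
    (hh0 : ∀ j, 0 ≤ h0 j) (hhl : Tendsto h0 atTop (𝓝 hl)) (hcl : Tendsto c atTop (𝓝 cl))
    (hcs : ∀ᶠ j in atTop, ‖c j‖ ^ 2 ≤ g j (2 * σ) * h0 j) {ε : ℝ} (hε : 0 < ε) :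
    ∀ᶠ j in atTop, ‖c j‖ ≤ Real.exp (-(μ * σ)) * Real.sqrt (g j 0) * Real.sqrt (h0 j) + ε := by
  have hchord := csclReal_chordLimit μ C ν g gl hμ hν hg0 hlc hfar hgl (2 * σ)
  have hgl0 : 0 ≤ gl 0 := ge_of_tendsto' (hgl 0) fun j => hg0 j 0 (Nat.zero_le _)
  have hhl0 : 0 ≤ hl := ge_of_tendsto' hhl hh0
  -- the limit Cauchy–Schwarz inequality
  have hlim : ‖cl‖ ^ 2 ≤ gl (2 * σ) * hl :=
    le_of_tendsto_of_tendsto ((continuous_norm.tendsto _).comp hcl |>.pow 2) ((hgl (2 * σ)).mul hhl) hcs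
  set R : ℝ := Real.exp (-(μ * σ)) * Real.sqrt (gl 0) * Real.sqrt hl with hR
  have hR0 : 0 ≤ R := by positivity
  have hcl_le : ‖cl‖ ≤ R := by
    have h1 : ‖cl‖ ^ 2 ≤ R ^ 2 := by
      calc ‖cl‖ ^ 2 ≤ gl (2 * σ) * hl := hlim
        _ ≤ gl 0 * Real.exp (-(μ * ((2 * σ : ℕ) : ℝ))) * hl := mul_le_mul_of_nonneg_right hchord hhl0
        _ = R ^ 2 := by
          have he : Real.exp (-(μ * ((2 * σ : ℕ) : ℝ))) = Real.exp (-(μ * σ)) ^ 2 := by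
            rw [← Real.exp_nat_mul]; push_cast; ring_nf
          rw [hR, mul_pow, mul_pow, Real.sq_sqrt hgl0, Real.sq_sqrt hhl0, he]
          ring
    exact (pow_le_pow_iff_left₀ (norm_nonneg _) hR0 (by norm_num : (2 : ℕ) ≠ 0)).1 h1
  -- the two sides converge; compare with the limits
  have hL : Tendsto (fun j => ‖c j‖) atTop (𝓝 ‖cl‖) := (continuous_norm.tendsto _).comp hcl
  have hRj : Tendsto (fun j => Real.exp (-(μ * σ)) * Real.sqrt (g j 0) * Real.sqrt (h0 j) + ε) atTop
      (𝓝 (R + ε)) :=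
    ((((hgl 0).sqrt).const_mul (Real.exp (-(μ * σ)))).mul hhl.sqrt).add_const ε
  have h1 : ∀ᶠ j in atTop, ‖c j‖ < R + ε / 2 := hL.eventually_lt_const (by linarith)
  have h2 : ∀ᶠ j in atTop, R + ε / 2 < Real.exp (-(μ * σ)) * Real.sqrt (g j 0) * Real.sqrt (h0 j) + ε :=
    hRj.eventually_const_lt (by linarith)
  filter_upwards [h1, h2] with j hj1 hj2
  exact (hj1.trans hj2).le

end Helpers

/-- **Registered anchor of this file** (closed form of `ivcs_integral_cfgReflect`, for the gate's `--supports` stub check):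
site-reflection invariance of the lifted torus Wilson state for complex integrands. [folklore] -/
theorem cscl_anchor_ivcsA :
    ∀ (G : Type) [Group G] [TopologicalSpace G] [IsTopologicalGroup G] [CompactSpace G]
      [MeasurableSpace G] [BorelSpace G] (r : LatticeRep G) (β : ℝ) (S : ℕ) (g : LGConfig 4 G → ℂ),
      ∫ U : GaugeConfig 4 (2 * S + 1) G, g (cfgReflect (torusLift (2 * S + 1) U)) ∂(wilsonMeasure r.ρ β) =
        ∫ U : GaugeConfig 4 (2 * S + 1) G, g (torusLift (2 * S + 1) U) ∂(wilsonMeasure r.ρ β) :=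
  fun _ _ _ _ _ _ _ r β S g => ivcs_integral_cfgReflect r.ρ r.continuous β (2 * S + 1) g

end Summit.QuantumFields.YangMills.Theorems.ContinuumLegGivenGap

end
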